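import Summits.ResolutionOfSingularities.ResolutionOfSingularities.Theorems.FrobeniusClosingSteerWords30SigmaLeafParS
import Summits.ResolutionOfSingularities.ResolutionOfSingularities.Theorems.FrobeniusClosingSteerWords12MemberDatum
import Summits.ResolutionOfSingularities.ResolutionOfSingularities.Theorems.FrobeniusClosingSteerVisitLawDelta
import HarnessLib

/-!
# Crux `Steer` (stmt-ResolutionOfSingularities-16345), β-leaf debt K-β0(b) `arithTransport_of` — the (B4)/(T′) RUN WORDS
  (res-L0-w41-strat-2 g4, STRATEGIST λ2 = words author; res-L0-w41-plan-1 RULINGS 268(a3)/274(c)/280(e)/288(e); answer to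
  res-L0-w41-stub-4 g7 20:41:25Z «ASSEMBLY SHAPE (T′), frame-free, anisotropy-level» and `GR-BRIDGE-HANDOFF.md` §«What remains» 1./4./5.)

OURS (campaign `res-hironaka`, rung L ★L-G4, slot W4.1). Candidates, not facts; nothing here is a statement of H. Hironaka's manuscript
[Hironaka2017] (status: under review). AI-written; AI review is weaker than expert review. SIGNATURES (six `def … : Prop` words + four frame-free
cone predicates) and two `Iff.rfl` bookkeeping lemmas; 0 sorries. Nothing is filed by this seat: the β-leaf assembler / stub-4's successor files.

## VERDICT ON stub-4's CUT (T′) — kept in spirit, RE-INDEXED over VISIT PAIRS, SIX words not two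

stub-4 asked for ONE point-step-free cone predicate `AnisotropicConeAt` and TWO words (T′-point)/(T′-curve) «stage j+1 has an anisotropic degree-d
cone ⇒ stage j is arithmetic», to run a downward induction along CONSECUTIVE stages. Two corrections, both forced by the member law:

* **(B3) is MOOT — index by VISIT PAIRS, not by `j ↦ j+1`.** Late, EVERY non-point step lies strictly inside a visit pair `(j, j′)` and is the strip
  along the new exceptional divisor (`ArithLeaf.eventuallyOnlyExcStripsTwoN_holds` p564693 ✓ = HΓ; height-≥2 centres are finitely many by the
  `¬ HeightTwoStepsInfinite` binder); the PROVED composite law `VisitLawDelta.visitLaw₂_of_run` (p544279 ✓) already swallows the strips: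
  `R j′ = R (j+1)` and `s j′ · x^(ν/2) · W = s j − G`. So there is NO curve-step word: the induction runs over consecutive POINT steps. (At an
  intermediate strip stage the member is `x^(2m) · f_{j′} + □`, whose cone has degree `d + 2m`: a per-stage degree-d predicate is FALSE there.)
* **A-shape vs B-shape.** Between two A-stages (odd cleaned order `d`, cone `Ψ̄(M₁,M₂)`) the run passes through ≥ 1 B-stage (cleaned order `d+1`,
  ONE odd divisor `x`, cone `X·Ψ̄(N₁,N₂) + X²·Θ` — tri-1 D·S3/D·S4, `…Words12MemberDatum`): `A → B → … → B → A`. The degree-d A-predicate is FALSE at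
  B-stages, so the induction needs a B-twin predicate ALONG the odd divisor `x : K` (followed across stages as `x`, `x/u`, …, exactly as
  `VisitLawAt` (5) follows it). Hence FOUR predicates (`BinaryConeE2At` / `AnisotropicConeAt` = the bodies of the β-leaf's `BinaryConeAt` / W30's
  `ArithBinaryResidueAt` minus `IsPointStep`, VERBATIM; `BinaryBConeE2At` / `AnisotropicBConeAt` = their B-twins along `x`) and SIX VISIT-LOCAL words:
  two FORWARD shape words (F-AB), (F-BB) carrying `e = 2` from an A-stage into and along the B-chain (the β-leaf's K-β0(a) `TernaryConePersistsTwoN`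
  re-supplies `e = 2` at every A-stage, so no (F-BA)); one TYPING word (T-R) «a return visit lands on an A-stage» (no fresh odd divisor is born at a
  return); three PULL-BACK words (P-AB), (P-BB), (P-BA) carrying ANISOTROPY backwards across one visit. All six are LOCAL ALGEBRA on one visit pair
  (binders: the run, dominance, regular members of dimension 4, the pair's HΓ clause and N4 height-one hygiene at `j′` — exactly what
  `visitLaw₂_of_run` eats — plus the stage typings); NO tail binders, NO `∃ i₀`: lateness is the ASSEMBLER's business (it has hS1b, HΓ, HYG by name).
* **(B4-i) order constancy is NOT a word**: it is hS1b's conclusion `EventuallyConstantReducedOrder R P s 2` (tree word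
  `ArithLeaf.EventuallyConstantReducedOrderTwoN`, T-line binder hS1b; words W-PC6a ✓ / W-TOI ✓ / W-PC6b filing) read through `HasReducedOrderAt`;
  the words below take the typings `IsAStageAt … d` / `IsBStageAt … x` + `HasCleanedOrderAt … (d+1)` as HYPOTHESES, discharged by the assembler from hS1b
  + `visitLaw₂_of_run` (3)/(5). CONSEQUENCE FOR THE β-LEAF: `arithTransport_of` must take `(hS1b : ArithLeaf.EventuallyConstantReducedOrderTwoN)` (and the
  K-β0(a) conclusion) as extra hypotheses — harmless on the T-line (hS1b is a T-line binder; the feeder passes it), desk to book the re-thread; and the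
  leaf's `ArithTransportTwoN` should bind `d` under `Odd d → 3 ≤ d →` (its only consumer `arithPersistence_of` has `hd h3` in scope) — as typed it
  quantifies EVERY `d`, and for even `d` a `BinaryConeAt d i` at an odd-cleaned point step is a genuine (square-cone) configuration nobody needs.
* **(B4-ii) near-point law is NOT a separate word either**: it lives INSIDE the proofs of (F-AB)/(F-BB)/(P-AB)/(P-BB) as the OFF-LINE CONTRADICTION
  (below), and at a RETURN (P-BA)/(T-R) it is not even true (toy `f = z^d + ρ` below) — but anisotropy transport survives there because a translation
  does not change the top-degree form. This is why the words are frame-free and anisotropy-level (stub-4's point (2)), not «Ψ̄′ = λ·Ψ̄».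

## THE MECHANISM the provers should follow (one visit `(j, j′)`, exceptional `u` of the step at `j`, `R′ := R j′ = R (j+1)`, `𝔪_j R′ = uR′`)

(on-line / off-line = the centre of `R′` on the exceptional divisor lies on / off the line `V(N₁, N₂)` of the transported pair.)
* A→B push-forward: `f′ = g₁² + u·Ψ(m/u) + u²ρ″` (`f − g² − Ψ(m) = ρ = u^(d+1)ρ″`). OFF-line (`m̄ₖ/u ≠ 0`): `Ψ(m/u)` is a unit (⇒ cleaned order ≤ 1)
  or `ζ^r·U + u·C` with `ζ` the lifted irreducible factor at the root direction, a regular parameter of `R′/u`, `r ≤ d − 1` by `e = 2` (⇒ cleaned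
  order ≤ r + 1 ≤ d: if `f′ − h² ∈ 𝔪′^(r+2)` then mod `u` the cleaner splits `h = g₁ + S₀ + uS₁`, `S₀² ∈ 𝔪′^(r+2)`, leaving `ζ^r U ∈ (u) + 𝔪′^(r+1)`,
  absurd in the regular ring `R′/u`) — both contradict the B-typing `ν′ = d + 1`. ON-line: re-clean `u²ρ″ ≡ u²S₁²`, remainder `u²θ`, `θ ∈ 𝔪′^(d−1)` ⇒
  the COARSE B-predicate along `u` in the pair `(m₁/u, m₂/u)` with the SAME `Ψ` (F-AB); `e = 2` is stable under `κ_j ⊆ κ_{j′}` for odd `d`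
  (`c(X+βY)^d` has `X^(d−1)Y`-coefficient `cβ`, so `β ∈ κ_j`).
* B→B (`v x < v u`, next odd divisor `x/u ∈ 𝔪′`): `f′ = g₁² + (x/u)·Ψ(n/u) + (x/u)²·θ/u^(d−1)`; off-line dies the same way in `R′/(u, x/u)`; on-line
  re-clean ⇒ (F-BB).
* PULL-BACK on-line, all three cases: subtract the pushed-forward presentation from the hypothesis presentation at `j′`; reduce modulo the odd
  divisor (`u`, resp. `x/u`): the cleaner difference splits `S = S₀ + uS₁` with `S₀²` two degrees too high; divide by `u` (gr of a regular ring is a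
  domain) ⇒ `Ψ(m/u) − Ψ′(n′) ∈ (u) + 𝔪′^(d+1)` ⇒ in `gr(R′/u) = κ′[V̄, ·, ·]` the two binary forms AGREE: same plane (e = 2), `Ψ̄′ ≅ Ψ̄ ⊗ κ′` up to
  `GL₂(κ′)` ⇒ anisotropy descends to the SUBFIELD `κ_j` (P-AB), (P-BB).
* RETURN (`v x = v u`; take `u := x` itself, it is exceptional): `f′ = g₁² + Ψ(n/x) + θ/x^(d−1)`, and `R′/x = κ_j[v/x, n₁/x, n₂/x]_(centre)` is an
  EXPLICIT polynomial local ring over the FIELD `κ_j = R_j/𝔪_j ⊆ R′/xR′` (coefficients from `R_j` are constants mod `x`): `θ/x^(d−1) mod x` is a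
  polynomial of `n`-degree ≤ d − 1 with coefficients in the DVR `κ_j[v/x]_(p_c)`, so its degree-d initial part is divisible by the `V`-parameter, and
  squares have no odd-degree part (char 2) ⇒ the `(N₁,N₂)`-PURE degree-d part of the cone at `j′` is `Ψ̄(N)` itself (stub-4's (G3) «pure part = λΨ̄»,
  here λ = 1) ⇒ any binary presentation `Ψ̄*(P₁,P₂)` of the A-cone at `j′` restricts on `X = V̄ = 0` to `Ψ̄` (planes complementary, else `e = 2` fails)
  ⇒ `Ψ̄ ≅ Ψ̄* ⊗`-restricted ⇒ anisotropy descends (P-BA); and the degree-d part is NON-ZERO and not a square ⇒ `ν′ = d` exactly ⇒ no fresh odd divisor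
  (T-R). OFF-line at a return is NOT contradictory (toy, dim-2 base, `d ≡ 3 (4)`: `f = z^d + Σ_b a_b x^(2d−2b) z^b` with `Σ_b a_b T^b = (T−c)^d − T^d + Q(T)²`
  returns at `z/x² = c ≠ 0` with cone `ζ^d`, `ζ = z/x² − c`): the translation `n ↦ n − c̃` leaves the top form `Ψ̄` unchanged, so (P-BA)/(T-R) still hold —
  the provers must NOT assume the near point at a return. This is the β-leaf docstring's «directrix jump» made precise: the PLANE may jump (to
  `⟨Z + X, W⟩`, say — realised by `ρ = Σ_k [X^k]Ψ̄(Z+X,W)·x^(3k)z^i w^j ∈ 𝔪^(d+2)`), the FORM does not.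

WHY THE WORDS MIGHT FAIL (one line each, for res-L0-w41-tri-1's vacuity/witness read): (F-AB)/(F-BB) — only if the re-cleaning `u²ρ″ ≡ u²S₁² (𝔪′^(d+1))`
needs more than `ν′ = d+1` (it does not: `S̄² ∈ 𝔪̄^(d+1)` in `R′/u` splits `S`); (P-AB)/(P-BB) — a hypothesis frame `(u, n₁′, n₂′)` at `j′` whose plane
CONTAINS the old exceptional direction (then the two planes mod `U` differ; the proof must show this contradicts `e = 2`, it does: equal forms, `e = 2`
⇒ equal planes); (P-BA)/(T-R) — a NON-RATIONAL (inseparable) return centre `c` where `κ_j[v/x]_(p_c)` is a DVR with residue field `κ_j(c)` but no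
coefficient field through `κ_j`: the argument above runs modulo `p_c(v/x)` and needs no coefficient field (checked here only on paper — the one place
a witness hunt should aim: `κ_j = k(a)` imperfect, return at `(v/x)² = a`).

NOT DONE HERE (successor / assembler, M): the INDUCTION `arithTransport_of_words : (F-AB) → (F-BB) → (T-R) → (P-AB) → (P-BB) → (P-BA) →
ArithLeaf.EventuallyConstantReducedOrderTwoN → «K-β0(a) conclusion» → ArithTransportTwoN(odd d)` over `visitLaw₂_of_run`, HΓ/HYG by name and hS1b:
forward pass from the odd-cleaned point step `i` (A-stage; `BinaryConeAt` ⇒ `BinaryConeE2At`) along visits, tracking the odd divisor `u₀, u₀/u₁, …`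
through each B-chain ((F-AB), (F-BB); at each A-stage K-β0(a) re-supplies `e = 2`; (T-R) + hS1b type the landing stage of a return); backward pass from
the arithmetic stage `i′` ((P-BA), (P-BB), …, (P-AB)), `ArithBinaryResidueAt = IsPointStep ∧ AnisotropicConeAt` (`Iff.rfl` below). The valuation
trichotomy `v x < v u ∨ v x = v u` at a B-stage (x ∈ P j ⇒ `v x ≤ v u`) selects (F-BB)/(P-BB) vs (P-BA)/(T-R) (in the `=` case `x` itself is
`IsExcParamAlong`, and HΓ holds for every exceptional parameter).
-/

-- `Summit.<S>.<S>.…` duplicates the summit name by design (single-problem summit).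
set_option linter.dupNamespace false

open IsLocalRing
open Literature.AlgebraicGeometry.Resolution (IsRsopPart SubringDominates)
open Summit.ResolutionOfSingularities.ResolutionOfSingularities.Theorems.SwitchingDichotomy.Words

namespace Summit.ResolutionOfSingularities.ResolutionOfSingularities.Theorems.SwitchingDichotomy.ArithTransport

section Predicates

variable {K : Type} [Field K]

/-- **A-shape, `e = 2` · `BinaryConeE2At`** — the body of the β-leaf's `BinaryConeAt R P s p d j` WITHOUT the `IsPointStep` conjunct (VERBATIM
otherwise; `BinaryConeAt R P s p d j ↔ IsPointStep R P j ∧ BinaryConeE2At R s p d j` is `Iff.rfl` in the leaf): the member `s j ^ p ∈ R j` is, modulo a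
square, a binary form `Ψ(m₁, m₂)` of degree `d` in an r.s.o.p.-part pair up to `𝔪^(d+1)`, and `Ψ̄` over `κ_j` is NOT a scalar multiple of a `d`-th power
of one linear form. OURS. [folklore] -/
def BinaryConeE2At (R : ℕ → Subring K) (s : ℕ → K) (p d j : ℕ) : Prop :=
  ∃ (_ : IsLocalRing (R j)) (hs : s j ^ p ∈ R j) (g m₁ m₂ : R j) (Ψ : MvPolynomial (Fin 2) (R j)),
    IsRsopPart ![m₁, m₂] ∧ Ψ.IsHomogeneous d ∧
    (⟨s j ^ p, hs⟩ : R j) - g ^ 2 - MvPolynomial.eval ![m₁, m₂] Ψ ∈ maximalIdeal (R j) ^ (d + 1) ∧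
    ¬ ∃ a b c : ResidueField (R j),
      MvPolynomial.map (residue (R j)) Ψ =
        MvPolynomial.C c * (MvPolynomial.C a * MvPolynomial.X 0 + MvPolynomial.C b * MvPolynomial.X 1) ^ d

/-- **A-shape, anisotropic · `AnisotropicConeAt`** (stub-4's suggested name) — the body of W30's `ArithBinaryResidueAt R P s p d j` WITHOUT the
`IsPointStep` conjunct, VERBATIM otherwise (`arithBinaryResidueAt_iff` below is `Iff.rfl`): binary degree-`d` cone in an r.s.o.p.-part pair whose
reduction over `κ_j` has no zero on `κ_j² ∖ 0`. OURS. [folklore] -/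
def AnisotropicConeAt (R : ℕ → Subring K) (s : ℕ → K) (p d j : ℕ) : Prop :=
  ∃ (_ : IsLocalRing (R j)) (hs : s j ^ p ∈ R j) (g m₁ m₂ : R j) (Ψ : MvPolynomial (Fin 2) (R j)),
    IsRsopPart ![m₁, m₂] ∧ Ψ.IsHomogeneous d ∧
    (⟨s j ^ p, hs⟩ : R j) - g ^ 2 - MvPolynomial.eval ![m₁, m₂] Ψ ∈ maximalIdeal (R j) ^ (d + 1) ∧
    ∀ a b : ResidueField (R j), (a ≠ 0 ∨ b ≠ 0) →
      MvPolynomial.eval ![a, b] (MvPolynomial.map (residue (R j)) Ψ) ≠ 0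

/-- **B-shape along `x`, `e = 2` · `BinaryBConeE2At`** — the COARSE B-twin: `x ∈ R j` extends to an r.s.o.p.-part `(x, n₁, n₂)`, and modulo a square
the member is `x · Ψ(n₁, n₂)` for a binary form `Ψ` of degree `d` UP TO `x² · 𝔪^(d−1) + 𝔪^(d+2)` (the pollution `X²·Θ`, `deg Θ = d − 1`, of the
B-stage cone `X·Ψ̄(N) + X²·Θ` is allowed — it is what the push-forward from an A-stage produces after re-cleaning, see the module docstring), with
`Ψ̄` not a scalar multiple of a `d`-th power of a linear form. The class determines the plane `⟨N̄₁, N̄₂⟩` modulo `X` and `Ψ̄` up to `GL₂(κ_j)` (reduce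
mod `(X², squares)`), so «anisotropic» below is presentation-free. That `x` IS the odd divisor is carried separately (`IsBStageAt`). OURS. [folklore] -/
def BinaryBConeE2At (R : ℕ → Subring K) (s : ℕ → K) (p : ℕ) (x : K) (d j : ℕ) : Prop :=
  ∃ (_ : IsLocalRing (R j)) (hx : x ∈ R j) (hs : s j ^ p ∈ R j) (g n₁ n₂ : R j) (Ψ : MvPolynomial (Fin 2) (R j)),
    IsRsopPart ![(⟨x, hx⟩ : R j), n₁, n₂] ∧ Ψ.IsHomogeneous d ∧
    (⟨s j ^ p, hs⟩ : R j) - g ^ 2 - ⟨x, hx⟩ * MvPolynomial.eval ![n₁, n₂] Ψ ∈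
      Ideal.span {(⟨x, hx⟩ : R j) ^ 2} * maximalIdeal (R j) ^ (d - 1) ⊔ maximalIdeal (R j) ^ (d + 2) ∧
    ¬ ∃ a b c : ResidueField (R j),
      MvPolynomial.map (residue (R j)) Ψ =
        MvPolynomial.C c * (MvPolynomial.C a * MvPolynomial.X 0 + MvPolynomial.C b * MvPolynomial.X 1) ^ d

/-- **B-shape along `x`, anisotropic · `AnisotropicBConeAt`** — as `BinaryBConeE2At` with «`Ψ̄` has no zero on `κ_j² ∖ 0`» in place of `e = 2`
(anisotropic ⇒ `e = 2`: `c·ℓ^d` vanishes on the kernel vector of `ℓ`). OURS. [folklore] -/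
def AnisotropicBConeAt (R : ℕ → Subring K) (s : ℕ → K) (p : ℕ) (x : K) (d j : ℕ) : Prop :=
  ∃ (_ : IsLocalRing (R j)) (hx : x ∈ R j) (hs : s j ^ p ∈ R j) (g n₁ n₂ : R j) (Ψ : MvPolynomial (Fin 2) (R j)),
    IsRsopPart ![(⟨x, hx⟩ : R j), n₁, n₂] ∧ Ψ.IsHomogeneous d ∧
    (⟨s j ^ p, hs⟩ : R j) - g ^ 2 - ⟨x, hx⟩ * MvPolynomial.eval ![n₁, n₂] Ψ ∈
      Ideal.span {(⟨x, hx⟩ : R j) ^ 2} * maximalIdeal (R j) ^ (d - 1) ⊔ maximalIdeal (R j) ^ (d + 2) ∧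
    ∀ a b : ResidueField (R j), (a ≠ 0 ∨ b ≠ 0) →
      MvPolynomial.eval ![a, b] (MvPolynomial.map (residue (R j)) Ψ) ≠ 0

/-- Bookkeeping (`Iff.rfl`): W30's `ArithBinaryResidueAt` is «point step ∧ `AnisotropicConeAt`». -/
theorem arithBinaryResidueAt_iff (R : ℕ → Subring K) (P : (i : ℕ) → Ideal (R i)) (s : ℕ → K) (p d j : ℕ) :
    ArithBinaryResidueAt R P s p d j ↔ IsPointStep R P j ∧ AnisotropicConeAt R s p d j :=
  Iff.rfl

/-- Bookkeeping: an anisotropic A-cone has `e = 2` (the kernel vector `(b, −a) ≠ 0` of `ℓ = aX + bY` is a zero of `c·ℓ^d`; for `a = b = 0` the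
form is `0` when `d ≥ 1` and vanishes at `(1, 0)`). Stated as a `Prop`-valued implication word so that this SIGNATURES file stays proof-free; the
assembler proves it in two lines (`MvPolynomial.eval` of `C c * (C a * X 0 + C b * X 1) ^ d` at `![b, -a]`). OURS. (folklore) -/
def AnisotropicImpliesE2 : Prop :=
  ∀ (K : Type) [Field K] (R : ℕ → Subring K) (s : ℕ → K) (p d j : ℕ), 1 ≤ d →
    AnisotropicConeAt R s p d j → BinaryConeE2At R s p d j

end Predicates

section Words

open Summit.ResolutionOfSingularities.ResolutionOfSingularities.Theorems.SwitchingDichotomy (SigmaTopLegality.IsSingPrime)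

/-! ### The six visit-local words. Common header: a steered run at `p = 2` in characteristic `2` with `R 0` dominated by `O`, every member regular of
Krull dimension `4` (HYG, `ArithLeaf.arithRunHygieneTwoN_holds` p563371 ✓ by name); a visit pair `(j, j′)`, an exceptional parameter of the step at `j`
with its HΓ strip clause (HΓ = `ArithLeaf.eventuallyOnlyExcStripsTwoN_holds` p564693 ✓, late) and N4's height-one hygiene at `j′` (HYG, late) — the
exact diet of `VisitLawDelta.visitLaw₂_of_run`; `d` odd `≥ 3`. -/

/-- **(F-AB) · `BinaryBConeAfterATwoN`** — FORWARD SHAPE, A → B: at a visit pair `(j, j′)` leaving an A-STAGE `j` of cleaned order `d` with an `e = 2`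
binary cone, exceptional parameter `u`, and landing (as it must, `visitLaw₂_of_run` (3)) on a stage of cleaned order `d + 1`: the member at `j′` has the
COARSE B-shape ALONG `u` with `e = 2` (indeed in the transported pair `(m₁/u, m₂/u)` with the same `Ψ` — the near-point law for this visit is INSIDE the
proof: off the line `V(M₁/u, M₂/u)` the cleaned order at `j′` is `≤ d`). Why it might fail: see module docstring (it should not). OURS. (folklore) -/
def BinaryBConeAfterATwoN : Prop :=
  ∀ (K : Type) [Field K] [CharP K 2] (O : ValuationSubring K)
    (R : ℕ → Subring K) (P : (i : ℕ) → Ideal (R i)) (t : K) (s : ℕ → K),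
    IsSteeredRun O R P t 2 s → SubringDominates (R 0) O.toSubring →
    (∀ i, IsRegularLocalRing (R i)) → (∀ i, ringKrullDim (R i) = (4 : ℕ)) →
    ∀ (j j' : ℕ) (u : K) (d : ℕ), Odd d → 3 ≤ d → IsVisitPair R P j j' → IsExcParamAlong O (R j) (P j) u →
      (∀ l, j < l → l < j' → ∃ hu : u ∈ R l, P l = Ideal.span {(⟨u, hu⟩ : R l)}) →
      (∀ (hs' : s j' ^ 2 ∈ R j') (Q : Ideal (R j')) [Q.IsPrime], Q.height = 1 →
        ¬ SigmaTopLegality.IsSingPrime (R j') 2 ⟨s j' ^ 2, hs'⟩ Q) →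
      IsAStageAt R P s 2 j d → BinaryConeE2At R s 2 d j →
      HasCleanedOrderAt R s 2 j' (d + 1) →
      BinaryBConeE2At R s 2 u d j'

/-- **(F-BB) · `BinaryBConeAfterBTwoN`** — FORWARD SHAPE, B → B: at a visit pair `(j, j′)` leaving a B-STAGE `j` (odd divisor `x`, cleaned order `d + 1`,
coarse `e = 2` B-shape along `x`) with exceptional parameter `u` of LARGER value than `x` (so `x/u ∈ 𝔪_{j′}` is the odd divisor at `j′`,
`visitLaw₂_of_run` (5)) and landing on a stage of cleaned order `d + 1`: the member at `j′` has the coarse `e = 2` B-shape ALONG `x/u` (transported pair,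
same `Ψ`; off-line the cleaned order at `j′` is `≤ d`). OURS. (folklore) -/
def BinaryBConeAfterBTwoN : Prop :=
  ∀ (K : Type) [Field K] [CharP K 2] (O : ValuationSubring K)
    (R : ℕ → Subring K) (P : (i : ℕ) → Ideal (R i)) (t : K) (s : ℕ → K),
    IsSteeredRun O R P t 2 s → SubringDominates (R 0) O.toSubring →
    (∀ i, IsRegularLocalRing (R i)) → (∀ i, ringKrullDim (R i) = (4 : ℕ)) →
    ∀ (j j' : ℕ) (x u : K) (d : ℕ), Odd d → 3 ≤ d → IsVisitPair R P j j' → IsExcParamAlong O (R j) (P j) u →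
      (∀ l, j < l → l < j' → ∃ hu : u ∈ R l, P l = Ideal.span {(⟨u, hu⟩ : R l)}) →
      (∀ (hs' : s j' ^ 2 ∈ R j') (Q : Ideal (R j')) [Q.IsPrime], Q.height = 1 →
        ¬ SigmaTopLegality.IsSingPrime (R j') 2 ⟨s j' ^ 2, hs'⟩ Q) →
      IsBStageAt R P s 2 j x → HasCleanedOrderAt R s 2 j (d + 1) → BinaryBConeE2At R s 2 x d j →
      O.valuation x < O.valuation u →
      HasCleanedOrderAt R s 2 j' (d + 1) →
      BinaryBConeE2At R s 2 (x / u) d j'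

/-- **(T-R) · `ReturnIsAStageTwoN`** — TYPING AT A RETURN: at a visit pair `(j, j′)` leaving a B-STAGE `j` (odd divisor `x`, cleaned order `d + 1`, coarse
`e = 2` B-shape along `x`) whose odd divisor `x` is ITSELF an exceptional parameter of the step (the RETURN visit, `v x` maximal on `P j`): the landing
stage has cleaned order EXACTLY `d` (the `(N₁,N₂)`-pure degree-`d` part of its cone is `Ψ̄ ≠ 0`, on-line or not — module docstring), hence — given
reduced order `d` there (hS1b) — it is an A-STAGE (no fresh odd divisor is born at a return). OURS. (folklore) -/
def ReturnIsAStageTwoN : Prop :=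
  ∀ (K : Type) [Field K] [CharP K 2] (O : ValuationSubring K)
    (R : ℕ → Subring K) (P : (i : ℕ) → Ideal (R i)) (t : K) (s : ℕ → K),
    IsSteeredRun O R P t 2 s → SubringDominates (R 0) O.toSubring →
    (∀ i, IsRegularLocalRing (R i)) → (∀ i, ringKrullDim (R i) = (4 : ℕ)) →
    ∀ (j j' : ℕ) (x : K) (d : ℕ), Odd d → 3 ≤ d → IsVisitPair R P j j' → IsExcParamAlong O (R j) (P j) x →
      (∀ l, j < l → l < j' → ∃ hx : x ∈ R l, P l = Ideal.span {(⟨x, hx⟩ : R l)}) →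
      (∀ (hs' : s j' ^ 2 ∈ R j') (Q : Ideal (R j')) [Q.IsPrime], Q.height = 1 →
        ¬ SigmaTopLegality.IsSingPrime (R j') 2 ⟨s j' ^ 2, hs'⟩ Q) →
      IsBStageAt R P s 2 j x → HasCleanedOrderAt R s 2 j (d + 1) → BinaryBConeE2At R s 2 x d j →
      HasReducedOrderAt R s 2 j' d →
      IsAStageAt R P s 2 j' d

/-- **(P-AB) · `AnisotropyPullbackABTwoN`** — PULL-BACK, A ← B: at a visit pair `(j, j′)` leaving an A-STAGE `j` (cleaned order `d`, `e = 2` binary cone)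
with exceptional parameter `u` and landing on a stage of cleaned order `d + 1` whose coarse B-shape ALONG `u` is ANISOTROPIC (in ANY presentation): the
cone at `j` is anisotropic over `κ_j` (the two degree-`d` forms agree in `gr(R_{j′}/u)`, `e = 2` equalises the planes, and `κ_j ⊆ κ_{j′}`). OURS. (folklore) -/
def AnisotropyPullbackABTwoN : Prop :=
  ∀ (K : Type) [Field K] [CharP K 2] (O : ValuationSubring K)
    (R : ℕ → Subring K) (P : (i : ℕ) → Ideal (R i)) (t : K) (s : ℕ → K),
    IsSteeredRun O R P t 2 s → SubringDominates (R 0) O.toSubring →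
    (∀ i, IsRegularLocalRing (R i)) → (∀ i, ringKrullDim (R i) = (4 : ℕ)) →
    ∀ (j j' : ℕ) (u : K) (d : ℕ), Odd d → 3 ≤ d → IsVisitPair R P j j' → IsExcParamAlong O (R j) (P j) u →
      (∀ l, j < l → l < j' → ∃ hu : u ∈ R l, P l = Ideal.span {(⟨u, hu⟩ : R l)}) →
      (∀ (hs' : s j' ^ 2 ∈ R j') (Q : Ideal (R j')) [Q.IsPrime], Q.height = 1 →
        ¬ SigmaTopLegality.IsSingPrime (R j') 2 ⟨s j' ^ 2, hs'⟩ Q) →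
      IsAStageAt R P s 2 j d → BinaryConeE2At R s 2 d j →
      HasCleanedOrderAt R s 2 j' (d + 1) → AnisotropicBConeAt R s 2 u d j' →
      AnisotropicConeAt R s 2 d j

/-- **(P-BB) · `AnisotropyPullbackBBTwoN`** — PULL-BACK, B ← B: at a visit pair `(j, j′)` leaving a B-STAGE `j` (odd divisor `x`, cleaned order `d + 1`,
coarse `e = 2` B-shape along `x`) with exceptional parameter `u` of larger value than `x`, landing on a stage of cleaned order `d + 1` whose coarse B-shape
ALONG `x/u` is anisotropic: the B-shape along `x` at `j` is anisotropic (forms agree in `gr(R_{j′}/(x/u))`). OURS. (folklore) -/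
def AnisotropyPullbackBBTwoN : Prop :=
  ∀ (K : Type) [Field K] [CharP K 2] (O : ValuationSubring K)
    (R : ℕ → Subring K) (P : (i : ℕ) → Ideal (R i)) (t : K) (s : ℕ → K),
    IsSteeredRun O R P t 2 s → SubringDominates (R 0) O.toSubring →
    (∀ i, IsRegularLocalRing (R i)) → (∀ i, ringKrullDim (R i) = (4 : ℕ)) →
    ∀ (j j' : ℕ) (x u : K) (d : ℕ), Odd d → 3 ≤ d → IsVisitPair R P j j' → IsExcParamAlong O (R j) (P j) u →
      (∀ l, j < l → l < j' → ∃ hu : u ∈ R l, P l = Ideal.span {(⟨u, hu⟩ : R l)}) →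
      (∀ (hs' : s j' ^ 2 ∈ R j') (Q : Ideal (R j')) [Q.IsPrime], Q.height = 1 →
        ¬ SigmaTopLegality.IsSingPrime (R j') 2 ⟨s j' ^ 2, hs'⟩ Q) →
      IsBStageAt R P s 2 j x → HasCleanedOrderAt R s 2 j (d + 1) → BinaryBConeE2At R s 2 x d j →
      O.valuation x < O.valuation u →
      HasCleanedOrderAt R s 2 j' (d + 1) → AnisotropicBConeAt R s 2 (x / u) d j' →
      AnisotropicBConeAt R s 2 x d j

/-- **(P-BA) · `AnisotropyPullbackBATwoN`** — PULL-BACK AT A RETURN, B ← A: at a visit pair `(j, j′)` leaving a B-STAGE `j` (odd divisor `x`, cleaned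
order `d + 1`, coarse `e = 2` B-shape along `x`) whose odd divisor `x` is itself exceptional (the return), landing on an A-STAGE of cleaned order `d`
with an anisotropic binary cone (any presentation): the B-shape along `x` at `j` is anisotropic (`R_{j′}/x` is a polynomial local ring over the field
`κ_j`; the `(N₁,N₂)`-pure degree-`d` part of the landing cone is `Ψ̄`; a translation at an off-line centre does not change it). OURS. (folklore) -/
def AnisotropyPullbackBATwoN : Prop :=
  ∀ (K : Type) [Field K] [CharP K 2] (O : ValuationSubring K)
    (R : ℕ → Subring K) (P : (i : ℕ) → Ideal (R i)) (t : K) (s : ℕ → K),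
    IsSteeredRun O R P t 2 s → SubringDominates (R 0) O.toSubring →
    (∀ i, IsRegularLocalRing (R i)) → (∀ i, ringKrullDim (R i) = (4 : ℕ)) →
    ∀ (j j' : ℕ) (x : K) (d : ℕ), Odd d → 3 ≤ d → IsVisitPair R P j j' → IsExcParamAlong O (R j) (P j) x →
      (∀ l, j < l → l < j' → ∃ hx : x ∈ R l, P l = Ideal.span {(⟨x, hx⟩ : R l)}) →
      (∀ (hs' : s j' ^ 2 ∈ R j') (Q : Ideal (R j')) [Q.IsPrime], Q.height = 1 →
        ¬ SigmaTopLegality.IsSingPrime (R j') 2 ⟨s j' ^ 2, hs'⟩ Q) →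
      IsBStageAt R P s 2 j x → HasCleanedOrderAt R s 2 j (d + 1) → BinaryBConeE2At R s 2 x d j →
      IsAStageAt R P s 2 j' d → AnisotropicConeAt R s 2 d j' →
      AnisotropicBConeAt R s 2 x d j

end Words

end Summit.ResolutionOfSingularities.ResolutionOfSingularities.Theorems.SwitchingDichotomy.ArithTransport
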